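import Mathlib.NumberTheory.NumberField.Basic
import Mathlib.RingTheory.Norm.Transitivity
import Mathlib.RingTheory.Trace.Basic
import Mathlib.FieldTheory.PrimitiveElement
import Mathlib.NumberTheory.NumberField.InfinitePlace.Embeddings
import HarnessLib

/-!
# Integrality in a cubic number field from the trace and norm forms

Topic `NumberTheory/NumberFields`. For a number field `K` of degree `3` and `φ ∈ K`, the three
embeddings `σ₀, σ₁, σ₂ : K → ℂ` give `Tr φ = Σ σᵢ φ`, `N φ = Π σᵢ φ`, and the second elementary
symmetric function `e₂(φ) = Σ_{i<j} σᵢ φ σⱼ φ = (Tr(φ)² − Tr(φ²))/2`; `φ` is a root of its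
characteristic polynomial `X³ − Tr(φ) X² + e₂(φ) X − N(φ) ∈ ℚ[X]` (`cubic_charpoly_relation`).
Consequently (`isIntegral_iff_trace_norm`):

  `φ` is an algebraic integer iff `Tr φ ∈ ℤ`, `Tr(φ)² − Tr(φ²) ∈ 2ℤ` and `N φ ∈ ℤ`

(⇐: the characteristic polynomial is monic with integer coefficients; ⇒: traces and norms of
algebraic integers are integers, and `e₂(φ)` is a rational algebraic integer). This is the exact
integrality test used by round-2-free computations of the maximal order of a cubic field from its
trace and norm forms (Cohen, GTM 138, §4.1, Prop. 4.1.5 / §6.4.5 for pure cubic fields).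

NOT here: higher degrees (the same argument with all elementary symmetric functions).

## References

* H. Cohen, *A Course in Computational Algebraic Number Theory*, GTM 138, Springer (1993),
  §4.1 (algebraic integers, characteristic polynomial), §6.4.5. [Cohen1993]
* D. A. Marcus, *Number Fields*, 2nd ed. (2018), Ch. 2 (Thm. 4 and Cor. 2: trace/norm via
  embeddings; integrality via monic integer polynomials). [Marcus2018]
-/

namespace Literature.NumberTheory.NumberFields

open scoped NumberField

variable {K : Type*} [Field K] [NumberField K]

/-- **The three embeddings of a cubic number field.** If `[K : ℚ] = 3` there are embeddings
`σ 0, σ 1, σ 2 : K →ₐ[ℚ] ℂ` with `Tr x = σ 0 x + σ 1 x + σ 2 x` and `N x = σ 0 x · σ 1 x · σ 2 x`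
for every `x ∈ K` (an enumeration of `K →ₐ[ℚ] ℂ`, of cardinality `[K : ℚ]`). [cite: Marcus2018, Ch. 2, Thm. 4] -/
theorem exists_embeddings_of_finrank_eq_three (h3 : Module.finrank ℚ K = 3) :
    ∃ σ : Fin 3 → (K →ₐ[ℚ] ℂ), ∀ x : K,
      algebraMap ℚ ℂ (Algebra.trace ℚ K x) = σ 0 x + σ 1 x + σ 2 x ∧
      algebraMap ℚ ℂ (Algebra.norm ℚ x) = σ 0 x * σ 1 x * σ 2 x := by
  have hcard : Fintype.card (K →ₐ[ℚ] ℂ) = 3 := by rw [AlgHom.card, h3]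
  let e : (K →ₐ[ℚ] ℂ) ≃ Fin 3 := Fintype.equivFinOfCardEq hcard
  refine ⟨fun i => e.symm i, fun x => ⟨?_, ?_⟩⟩
  · rw [trace_eq_sum_embeddings ℂ (K := ℚ) (L := K), ← e.symm.sum_comp, Fin.sum_univ_three]
  · rw [Algebra.norm_eq_prod_embeddings ℚ ℂ x, ← e.symm.prod_comp, Fin.prod_univ_three]

/-- **Cayley–Hamilton in a cubic field, via embeddings.** For `[K : ℚ] = 3` and `φ ∈ K`:
`φ³ − Tr(φ) φ² + ((Tr(φ)² − Tr(φ²))/2) φ − N(φ) = 0` (apply an embedding: `σ₀ φ` is a root of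
`Π (X − σᵢ φ)`, whose coefficients are `Tr`, `e₂ = (Tr² − Tr(φ²))/2`, `N`). [cite: Cohen1993, §4.1] -/
theorem cubic_charpoly_relation (h3 : Module.finrank ℚ K = 3) (φ : K) :
    φ ^ 3 - algebraMap ℚ K (Algebra.trace ℚ K φ) * φ ^ 2 +
      algebraMap ℚ K ((Algebra.trace ℚ K φ ^ 2 - Algebra.trace ℚ K (φ ^ 2)) / 2) * φ -
      algebraMap ℚ K (Algebra.norm ℚ φ) = 0 := by
  obtain ⟨σ, hσ⟩ := exists_embeddings_of_finrank_eq_three h3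
  have hinj : Function.Injective (σ 0) := (σ 0).toRingHom.injective
  rw [← map_eq_zero_iff _ hinj]
  simp only [map_sub, map_add, map_mul, map_pow, AlgHom.commutes]
  rw [(hσ φ).1, (hσ φ).2, map_div₀, map_sub, map_pow, (hσ φ).1, (hσ (φ ^ 2)).1, map_ofNat]
  simp only [map_pow]
  ring

/-- **Integrality criterion in a cubic field from traces and norms.** For `[K : ℚ] = 3` and
`φ ∈ K`: `φ` is integral over `ℤ` iff `Tr φ ∈ ℤ`, `Tr(φ)² − Tr(φ²) ∈ 2ℤ` (i.e. `e₂(φ) ∈ ℤ`) and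
`N φ ∈ ℤ` — i.e. iff the characteristic polynomial `X³ − Tr X² + e₂ X − N` has integer
coefficients. [cite: Cohen1993, §4.1] -/
theorem isIntegral_iff_trace_norm (h3 : Module.finrank ℚ K = 3) (φ : K) :
    IsIntegral ℤ φ ↔
      (∃ t : ℤ, Algebra.trace ℚ K φ = t) ∧
      (∃ s : ℤ, Algebra.trace ℚ K φ ^ 2 - Algebra.trace ℚ K (φ ^ 2) = 2 * s) ∧
      (∃ n : ℤ, Algebra.norm ℚ φ = n) := by
  constructor
  · intro hφ
    refine ⟨?_, ?_, ?_⟩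
    · obtain ⟨t, ht⟩ := IsIntegrallyClosed.isIntegral_iff.mp (Algebra.isIntegral_trace (L := ℚ) hφ)
      exact ⟨t, by rw [← ht]; rfl⟩
    · obtain ⟨σ, hσ⟩ := exists_embeddings_of_finrank_eq_three h3
      set q : ℚ := (Algebra.trace ℚ K φ ^ 2 - Algebra.trace ℚ K (φ ^ 2)) / 2 with hq
      have hqC : algebraMap ℚ ℂ q = σ 0 φ * σ 1 φ + σ 0 φ * σ 2 φ + σ 1 φ * σ 2 φ := by
        rw [hq, map_div₀, map_sub, map_pow, (hσ φ).1, (hσ (φ ^ 2)).1, map_ofNat]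
        simp only [map_pow]
        ring
      have hqi : IsIntegral ℤ q := by
        rw [← isIntegral_algebraMap_iff (algebraMap ℚ ℂ).injective, hqC]
        exact ((map_isIntegral_int (σ 0) hφ).mul (map_isIntegral_int (σ 1) hφ)).add
          ((map_isIntegral_int (σ 0) hφ).mul (map_isIntegral_int (σ 2) hφ)) |>.add
          ((map_isIntegral_int (σ 1) hφ).mul (map_isIntegral_int (σ 2) hφ))
      obtain ⟨s, hs⟩ := IsIntegrallyClosed.isIntegral_iff.mp hqi
      refine ⟨s, ?_⟩
      have : (s : ℚ) = q := by rw [← hs]; rfl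
      rw [this, hq]
      ring
    · obtain ⟨n, hn⟩ := IsIntegrallyClosed.isIntegral_iff.mp (Algebra.isIntegral_norm ℚ hφ)
      exact ⟨n, by rw [← hn]; rfl⟩
  · rintro ⟨⟨t, ht⟩, ⟨s, hs⟩, ⟨n, hn⟩⟩
    have hrel := cubic_charpoly_relation h3 φ
    rw [ht, hn, show (t : ℚ) ^ 2 - Algebra.trace ℚ K (φ ^ 2) = 2 * s by rw [← ht, hs],
      mul_div_cancel_left₀ _ (two_ne_zero' ℚ)] at hrel
    refine ⟨Polynomial.X ^ 3 - Polynomial.C t * Polynomial.X ^ 2 + Polynomial.C s * Polynomial.X -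
      Polynomial.C n, ?_, ?_⟩
    · monicity!
    · simp only [Polynomial.eval₂_sub, Polynomial.eval₂_add, Polynomial.eval₂_mul,
        Polynomial.eval₂_pow, Polynomial.eval₂_X, Polynomial.eval₂_C]
      rw [map_intCast, map_intCast, map_intCast] at hrel
      simpa only [eq_intCast] using hrel

end Literature.NumberTheory.NumberFields
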